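import Summits.NavierStokesRegularity.NavierStokesRegularity.Theses.AxisymmetricExtremality
import Literature.Analysis.FluidPDE.SereginSverakAxisymmetric
import Literature.Analysis.FluidPDE.CylindricalIntegration
import Literature.Analysis.FluidPDE.AxisymQuotientBounds
import Literature.Analysis.FluidPDE.AxisymWeights
import Literature.Analysis.FluidPDE.SereginZajaczkowski2007L42VorticityProofs
import HarnessLib

/-!
# Seregin 2022, §2 Step 4: the `v_θ` passage (`x₃`-Poincaré on the cylinder and
# `|∂₃(η³v_θ)| ≤ r|η³Φ| + |∂₃η³||v_θ|`) — crux stmt-NavierStokesRegularity-15453 (`AxisymmetricExtremality.AxisymmetricKatoGlobal`), line registered, support for stub `stub_sereginLogSwirlOrigin`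

Support file (`--supports stmt-NavierStokesRegularity-15453`; theorems only, everything proved)
toward the registered stub `stub_sereginLogSwirlOrigin` = the named fact
`Literature.Analysis.FluidPDE.seregin2022_logSwirl_regularAtOrigin` (G. Seregin, J. Math. Fluid
Mech. 24 (2022), Paper 27 = arXiv:2201.00153, §2).  Step 4 of that proof shows
`C(R) = R⁻²∫_{Q(R)}|v|³ → 0`; the swirl component `v_θ` is handled by the passage (arXiv p. 7)

> `η³v_θ(r,x₃,t) = ∫_{-1}^{x₃} (η³v_θ),₃(r,y,t) dy` and thus
> `sup_{x₃}|η³v_θ(r,x₃,t)| ≤ c(∫_{-1}^{1}|(η³v_θ),₃(r,y,t)|^{10/3}dy)^{3/10}`, re-written so that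
> `sup_{x₃}(1/r)|η³v_θ| ≤ c(∫_{-1}^{1}(|Φη³| + |(η³),₃||v_θ|/r)^{10/3}dy)^{3/10}` …
> `∫_{Q(R)}|v_θ|^{10/3}dz ≤ ∫∫(R^{10/3}∫_{-R}^{R}|v_θ/r|^{10/3}dx₃) r dr dt ≤ cR^{10/3+1}[…]`,

with `Φ = ω_r/r = -v_{θ,3}/r` (arXiv p. 6).  In tree vocabulary (`swirlVelocity = v_θ`,
`radialVelocity (curl v) = ω_r`, `radVelQuot (curl v) = Φ`, `SereginSverak2009.spaceCyl 0 R = 𝒞(R)`,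
`∂₃ = D(·)[EuclideanSpace.single 2 1]`) this file proves both ingredients:

* `fderiv_swirlVelocity_single_two` — **`∂₃v_θ = -ω_r`** off the axis for an axisymmetric field
  differentiable at the point (`rω_r = x₀ω₀ + x₁ω₁ = -∂₃Γ` by the infinitesimal axisymmetry
  `(Du[Jx])₂ = 0`), and `fderiv_swirlVelocity_single_two_eq_neg_mul_radVelQuot` — `∂₃v_θ = -rΦ`
  for `v ∈ C³` with the tree's smooth quotient `Φ = radVelQuot (curl v)`;
* `abs_fderiv_mul_swirlVelocity_single_two_le_radVelQuot` (registered) — the printed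
  **`|∂₃(ζv_θ)| ≤ r|ζΦ| + |∂₃ζ||v_θ|`** (`ζ = η³`); `C¹` form `abs_fderiv_mul_swirlVelocity_single_two_le`
  with `ω_r` for `rΦ`;
* `eq_integral_fderiv_vline`, `enorm_le_lintegral_vline` — `F(x',x₃) = ∫_{-1}^{x₃} ∂₃F(x',s) ds`
  along the vertical line `s ↦ x + (s - x₃)e₂`, for `F ∈ C¹` off the axis, `F = 0` where `x₃ ≤ -1`;
* `lintegral_spaceCyl_rpow_le_lintegral_fderiv` (registered) — the **anisotropic `x₃`-Poincaré
  inequality** `∫_{𝒞(R)}|F|^p ≤ 2^pR ∫_{|x'|<R,|x₃|<1}|∂₃F|^p` (`p ≥ 1`, `R ≤ 1`): Hölder on `]-1,1[`,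
  the height `2R` of `𝒞(R)` against the full height of the derivative integral (the printed gain
  `R^{10/3+1}` once `|v_θ| ≤ R|v_θ/r|` is inserted), and Tonelli over `(x₃, x')` through the
  tree's volume-preserving `cylSplit : ℝ³ ≃ᵐ ℝ × ℝ²`; no measurability hypothesis is needed, a
  function continuous off the (null) axis being a.e.-measurable;
* `lintegral_spaceCyl_mul_swirlVelocity_rpow_le` (registered) — both combined:
  `∫_{𝒞(R)}|ζv_θ|^p ≤ 2^pR ∫_{|x'|<R,|x₃|<1}(|ζω_r| + |∂₃ζ v_θ|)^p` for `ζ ∈ C¹` vanishing where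
  `x₃ ≤ -1` and `v` axisymmetric, `C¹` near the off-axis points of `tsupport ζ`.

## References

* G. Seregin, J. Math. Fluid Mech. 24 (2022), Paper No. 27 = arXiv:2201.00153, §2 Step 4 (arXiv
  p. 7) and Step 3 (`Φ = ω_r/r = -v_{θ,3}/r`, arXiv p. 6). [`Seregin2022LocalAxisym`]
* Z. Lei, Q. S. Zhang, Pacific J. Math. 289 (2017), §1 (`J = ωʳ/r = -∂_z v^θ/r`). [`LeiZhang2017`]
-/

noncomputable section

open Set MeasureTheory Filter Topology Function Metric
open scoped ENNReal NNReal RealInnerProductSpace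
open Literature.Analysis.FluidPDE

-- `<Problem> = <Summit>` duplicates a namespace component by design (lakefile sets the same option).
set_option linter.dupNamespace false

namespace Summit.NavierStokesRegularity.NavierStokesRegularity.Theorems.AxisymmetricKatoGlobal.EulerScaling

section Swirl
variable {v : EuclideanSpace ℝ (Fin 3) → EuclideanSpace ℝ (Fin 3)} {x : EuclideanSpace ℝ (Fin 3)}

/-- **`r ω_r = -∂₃Γ`**: `x₀ω₀ + x₁ω₁ = -∂₃(swirl v)` wherever the axisymmetric `v` is differentiable
(`x₀ω₀ + x₁ω₁ = -(x₀∂₃v₁ - x₁∂₃v₀) + (Dv[Jx])₂` and `(Dv[Jx])₂ = (J v)₂ = 0`). [cite: Seregin2022LocalAxisym, §2 Step 4] -/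
theorem horizontal_curl_eq_neg_fderiv_swirl (hax : IsAxisymmetric v) (hd : DifferentiableAt ℝ v x) :
    x 0 * curl v x 0 + x 1 * curl v x 1 = -fderiv ℝ (swirl v) x (EuclideanSpace.single 2 1) := by
  -- adapted from `Literature.Analysis.FluidPDE.IsAxisymmetric.radVelQuot_curl_eq_neg_fderiv_angVelQuot`
  have hJ := congrArg (fun w : EuclideanSpace ℝ (Fin 3) => w 2) (hax.fderiv_rotGen hd)
  simp [rotGen_eq_sub_single] at hJ
  rw [fderiv_swirl_single_two hd]
  simp [swirl, curl]
  linear_combination hJ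

/-- `v_θ = r⁻¹Γ` is differentiable off the axis where `v` is:
`Dv_θ(x) = r⁻¹ DΓ(x) + Γ(x) D(r⁻¹)(x)`, `D(r⁻¹)(x) = -r⁻² ⟪e_r(x), ·⟫`. [folklore] -/
theorem hasFDerivAt_swirlVelocity (hd : DifferentiableAt ℝ v x) (hx : cylRadius x ≠ 0) :
    HasFDerivAt (swirlVelocity v)
      ((cylRadius x)⁻¹ • fderiv ℝ (swirl v) x +
        swirl v x • ((ContinuousLinearMap.toSpanSingleton ℝ (-(cylRadius x ^ 2)⁻¹)).comp
          (innerSL ℝ (eR x)))) x := by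
  rw [SereginZajaczkowski2007.swirlVelocity_eq_inv_mul_swirl]
  exact ((hasFDerivAt_inv hx).comp x (hasFDerivAt_cylRadius hx)).mul
    (differentiableAt_swirl hd).hasFDerivAt

/-- `v_θ` is `Cⁿ` at an off-axis point where `v` is. [folklore] -/
theorem contDiffAt_swirlVelocity_of_contDiffAt {n : WithTop ℕ∞} (hv : ContDiffAt ℝ n v x)
    (hx : cylRadius x ≠ 0) : ContDiffAt ℝ n (swirlVelocity v) x := by
  rw [SereginZajaczkowski2007.swirlVelocity_eq_inv_mul_swirl]
  refine ((contDiffAt_cylRadius hx).inv hx).mul ?_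
  rw [swirl_eq_inner_rotGen]
  exact (rotGenL.contDiff.contDiffAt (x := x)).inner ℝ hv

/-- **`∂₃ v_θ = -ω_r` off the axis** (Seregin: "`Φ = ω_r/r = -v_{θ,3}/r`"), for an axisymmetric
field differentiable at the point: `D(v_θ)(x)[e₂] = -radialVelocity (curl v) x` (`r` is constant
along `e₂`: `⟪e_r, e₂⟫ = 0`, and `r ω_r = -∂₃Γ`). [cite: Seregin2022LocalAxisym, §2 Step 4] -/
theorem fderiv_swirlVelocity_single_two (hax : IsAxisymmetric v) (hd : DifferentiableAt ℝ v x)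
    (hx : cylRadius x ≠ 0) :
    fderiv ℝ (swirlVelocity v) x (EuclideanSpace.single 2 1) = -radialVelocity (curl v) x := by
  rw [(hasFDerivAt_swirlVelocity hd hx).fderiv, SereginZajaczkowski2007.radialVelocity_eq_div,
    horizontal_curl_eq_neg_fderiv_swirl hax hd]
  have h2 : ⟪eR x, EuclideanSpace.single 2 (1 : ℝ)⟫ = 0 := inner_eR_eZ x
  simp only [add_apply, smul_apply, ContinuousLinearMap.comp_apply, innerSL_apply_apply, h2,
    ContinuousLinearMap.toSpanSingleton_apply, smul_eq_mul]
  field_simp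
  ring

/-- **`∂₃ v_θ = -rΦ`** with the tree's smooth quotient `Φ = radVelQuot (curl v) = ω_r/r`
(`IsAxisymmetric.cylRadius_sq_mul_radVelQuot`: `r²Φ = x₀ω₀ + x₁ω₁`), for an axisymmetric `v ∈ C³`
off the axis. [cite: Seregin2022LocalAxisym, §2 Step 4] -/
theorem fderiv_swirlVelocity_single_two_eq_neg_mul_radVelQuot (hax : IsAxisymmetric v)
    (hv : ContDiff ℝ 3 v) (hx : cylRadius x ≠ 0) :
    fderiv ℝ (swirlVelocity v) x (EuclideanSpace.single 2 1) =
      -(cylRadius x * radVelQuot (curl v) x) := by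
  have hud : Differentiable ℝ v := hv.differentiable (by norm_num)
  have hω2 : ContDiff ℝ 2 (curl v) := contDiff_curl_of_succ (n := 2) (by exact_mod_cast hv)
  rw [fderiv_swirlVelocity_single_two hax (hud x) hx, SereginZajaczkowski2007.radialVelocity_eq_div,
    ← (hax.curl hud).cylRadius_sq_mul_radVelQuot hω2 x]
  field_simp

/-- **`∂₃(ζ v_θ) = ∂₃ζ · v_θ - ζ ω_r`** off the axis (`ζ = η³` in Seregin's Step 4).
[cite: Seregin2022LocalAxisym, §2 Step 4] -/
theorem fderiv_mul_swirlVelocity_single_two (hax : IsAxisymmetric v) (hd : DifferentiableAt ℝ v x)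
    (hx : cylRadius x ≠ 0) {ζ : EuclideanSpace ℝ (Fin 3) → ℝ} (hζ : DifferentiableAt ℝ ζ x) :
    fderiv ℝ (fun y => ζ y * swirlVelocity v y) x (EuclideanSpace.single 2 1) =
      fderiv ℝ ζ x (EuclideanSpace.single 2 1) * swirlVelocity v x -
        ζ x * radialVelocity (curl v) x := by
  rw [fderiv_fun_mul hζ (hasFDerivAt_swirlVelocity hd hx).differentiableAt]
  simp only [add_apply, smul_apply, smul_eq_mul, fderiv_swirlVelocity_single_two hax hd hx]
  ring

/-- **`|∂₃(ζ v_θ)| ≤ |ζ ω_r| + |∂₃ζ| |v_θ|`** off the axis, `C¹` form (axisymmetric `v` and `ζ`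
differentiable at `x`). [cite: Seregin2022LocalAxisym, §2 Step 4] -/
theorem abs_fderiv_mul_swirlVelocity_single_two_le (hax : IsAxisymmetric v)
    (hd : DifferentiableAt ℝ v x) (hx : cylRadius x ≠ 0) {ζ : EuclideanSpace ℝ (Fin 3) → ℝ}
    (hζ : DifferentiableAt ℝ ζ x) :
    |fderiv ℝ (fun y => ζ y * swirlVelocity v y) x (EuclideanSpace.single 2 1)| ≤
      |ζ x * radialVelocity (curl v) x| +
        |fderiv ℝ ζ x (EuclideanSpace.single 2 1)| * |swirlVelocity v x| := by
  rw [fderiv_mul_swirlVelocity_single_two hax hd hx hζ, ← abs_mul]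
  exact (abs_sub _ _).trans_eq (add_comm _ _)

/-- **The printed `|(η³v_θ),₃| ≤ r|η³Φ| + |(η³),₃||v_θ|`** (Seregin: "`sup (1/r)|η³v_θ| ≤
c(∫ (|Φη³| + |(η³),₃||v_θ|/r)^{10/3} dy)^{3/10}`", from `Φ = ω_r/r = -v_{θ,3}/r`), with `ζ` for `η³`
and the tree's `Φ = radVelQuot (curl v)`: axisymmetric `v ∈ C³(ℝ³)`, `ζ` differentiable at the
off-axis point `x`. [cite: Seregin2022LocalAxisym, §2 Step 4] -/
theorem abs_fderiv_mul_swirlVelocity_single_two_le_radVelQuot : ∀ (v : EuclideanSpace ℝ (Fin 3) → EuclideanSpace ℝ (Fin 3)) (ζ : EuclideanSpace ℝ (Fin 3) → ℝ) (x : EuclideanSpace ℝ (Fin 3)), IsAxisymmetric v → ContDiff ℝ 3 v → DifferentiableAt ℝ ζ x → cylRadius x ≠ 0 → |fderiv ℝ (fun y => ζ y * swirlVelocity v y) x (EuclideanSpace.single 2 1)| ≤ cylRadius x * |ζ x * radVelQuot (curl v) x| + |fderiv ℝ ζ x (EuclideanSpace.single 2 1)| * |swirlVelocity v x| := by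
  intro v ζ x hax hv hζ hx
  have hud : Differentiable ℝ v := hv.differentiable (by norm_num)
  have h := abs_fderiv_mul_swirlVelocity_single_two_le hax (hud x) hx hζ
  have he : ζ x * radialVelocity (curl v) x = cylRadius x * (ζ x * radVelQuot (curl v) x) := by
    have h1 := fderiv_swirlVelocity_single_two hax (hud x) hx
    rw [fderiv_swirlVelocity_single_two_eq_neg_mul_radVelQuot hax hv hx, neg_inj] at h1
    rw [← h1]; ring
  rwa [he, abs_mul, abs_of_nonneg (cylRadius_nonneg x)] at h

end Swirl

section LineFTC
variable {F : EuclideanSpace ℝ (Fin 3) → ℝ} {x : EuclideanSpace ℝ (Fin 3)}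

/-- The vertical line `s ↦ x + (s - x₃)e₂` has velocity `e₂`. [folklore] -/
theorem hasDerivAt_vline (x : EuclideanSpace ℝ (Fin 3)) (s : ℝ) :
    HasDerivAt (fun t : ℝ => x + (t - x 2) • EuclideanSpace.single 2 (1 : ℝ))
      (EuclideanSpace.single 2 (1 : ℝ)) s := by
  simpa using (((hasDerivAt_id s).sub_const (x 2)).smul_const
    (EuclideanSpace.single (2 : Fin 3) (1 : ℝ))).const_add x

/-- In the split variables `(z, w)` of `cylSplit`, the vertical line through `(w, z)` at
parameter `s` is `(w, s)`. [folklore] -/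
theorem cylSplit_symm_vline (s z : ℝ) (w : EuclideanSpace ℝ (Fin 2)) :
    cylSplit.symm (z, w) + (s - z) • EuclideanSpace.single 2 (1 : ℝ) = cylSplit.symm (s, w) := by
  rw [cylSplit_symm_apply, cylSplit_symm_apply]
  ext i
  fin_cases i <;> simp

/-- **`F(x', x₃) = ∫_{-1}^{x₃} ∂₃F(x', s) ds`** (Seregin: "`η³v_θ(r,x₃,t) = ∫_{-1}^{x₃}
(η³v_θ),₃(r,y,t) dy`") for `F` of class `C¹` off the axis vanishing where `x₃ ≤ -1`, at every
off-axis point `x`. [cite: Seregin2022LocalAxisym, §2 Step 4] -/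
theorem eq_integral_fderiv_vline (hF : ∀ y, cylRadius y ≠ 0 → ContDiffAt ℝ 1 F y)
    (hF0 : ∀ y : EuclideanSpace ℝ (Fin 3), y 2 ≤ -1 → F y = 0) (hx : cylRadius x ≠ 0) :
    F x = ∫ s in (-1 : ℝ)..(x 2),
      fderiv ℝ F (x + (s - x 2) • EuclideanSpace.single 2 (1 : ℝ)) (EuclideanSpace.single 2 1) := by
  set ℓ : ℝ → EuclideanSpace ℝ (Fin 3) := fun s => x + (s - x 2) • EuclideanSpace.single 2 (1 : ℝ)
    with hℓ
  have hFℓ : ∀ s, ContDiffAt ℝ 1 F (ℓ s) := fun s => hF _ (by simpa [hℓ, cylRadius] using hx)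
  have hg : ∀ s, HasDerivAt (F ∘ ℓ) (fderiv ℝ F (ℓ s) (EuclideanSpace.single 2 1)) s := fun s =>
    ((hFℓ s).differentiableAt one_ne_zero).hasFDerivAt.comp_hasDerivAt s (hasDerivAt_vline x s)
  have hC1 : ContDiff ℝ 1 (F ∘ ℓ) := contDiff_iff_contDiffAt.2 fun s => (hFℓ s).comp s
    (contDiff_const.add ((contDiff_id.sub contDiff_const).smul contDiff_const)).contDiffAt
  have hcont : Continuous fun s => fderiv ℝ F (ℓ s) (EuclideanSpace.single 2 1) := by
    have he : deriv (F ∘ ℓ) = fun s => fderiv ℝ F (ℓ s) (EuclideanSpace.single 2 1) :=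
      funext fun s => (hg s).deriv
    simpa only [he] using hC1.continuous_deriv_one
  rw [intervalIntegral.integral_eq_sub_of_hasDerivAt (fun s _ => hg s) (hcont.intervalIntegrable _ _)]
  have h1 : (F ∘ ℓ) (x 2) = F x := by simp [hℓ]
  have h2 : (F ∘ ℓ) (-1) = 0 := hF0 _ (by simp [hℓ])
  rw [h1, h2, sub_zero]

/-- **`|F(x', x₃)| ≤ ∫_{-1}^{x₃} |∂₃F(x', s)| ds`** in `ℝ≥0∞` (no integrability proviso), for `F`
of class `C¹` off the axis vanishing where `x₃ ≤ -1`, at every off-axis point.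
[cite: Seregin2022LocalAxisym, §2 Step 4] -/
theorem enorm_le_lintegral_vline (hF : ∀ y, cylRadius y ≠ 0 → ContDiffAt ℝ 1 F y)
    (hF0 : ∀ y : EuclideanSpace ℝ (Fin 3), y 2 ≤ -1 → F y = 0) (hx : cylRadius x ≠ 0) :
    ‖F x‖ₑ ≤ ∫⁻ s in Ioc (-1) (x 2),
      ‖fderiv ℝ F (x + (s - x 2) • EuclideanSpace.single 2 (1 : ℝ)) (EuclideanSpace.single 2 1)‖ₑ := by
  rcases lt_or_ge (x 2) (-1) with h | h
  · simp [hF0 x h.le]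
  · rw [eq_integral_fderiv_vline hF hF0 hx, intervalIntegral.integral_of_le h]
    exact enorm_integral_le_lintegral_enorm _

end LineFTC

/-- **Hölder against the constant `1`**: `(∫ f)^p ≤ μ(univ)^{p-1} ∫ f^p` for `p ≥ 1`. [folklore] -/
theorem lintegral_rpow_le_measure_rpow_mul {α : Type*} [MeasurableSpace α] (μ : Measure α)
    {f : α → ℝ≥0∞} (hf : AEMeasurable f μ) {p : ℝ} (hp : 1 ≤ p) :
    (∫⁻ a, f a ∂μ) ^ p ≤ μ univ ^ (p - 1) * ∫⁻ a, f a ^ p ∂μ := by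
  have hp0 : 0 < p := one_pos.trans_le hp
  have h := eLpNorm'_le_eLpNorm'_mul_rpow_measure_univ one_pos hp hf.aestronglyMeasurable
  simp only [eLpNorm', enorm_eq_self, ENNReal.rpow_one, inv_one, one_div] at h
  have h2 := ENNReal.rpow_le_rpow h hp0.le
  rwa [ENNReal.mul_rpow_of_nonneg _ _ hp0.le, ← ENNReal.rpow_mul, ← ENNReal.rpow_mul,
    inv_mul_cancel₀ hp0.ne', ENNReal.rpow_one, show (1 - p⁻¹) * p = p - 1 by field_simp,
    mul_comm] at h2

/-- Almost every point of `ℝ³` is off the axis (the tree's `volume_axis_eq_zero`). [folklore] -/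
theorem ae_cylRadius_ne_zero_volume :
    ∀ᵐ y ∂(volume : Measure (EuclideanSpace ℝ (Fin 3))), cylRadius y ≠ 0 := by
  have h : volume {y : EuclideanSpace ℝ (Fin 3) | cylRadius y = 0} = 0 := by
    refine measure_mono_null (fun y hy => ?_) volume_axis_eq_zero
    rw [mem_setOf_eq, cylRadius_eq_zero_iff] at hy
    show y 0 ^ 2 + y 1 ^ 2 = 0
    simp [hy.1, hy.2]
  simpa [ae_iff] using h

/-- **A function continuous off the axis is a.e.-measurable** (the axis is null, its complement
open). [folklore] -/
theorem aemeasurable_of_continuousAt_off_axis {β : Type*} [MeasurableSpace β]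
    [TopologicalSpace β] [BorelSpace β] {F : EuclideanSpace ℝ (Fin 3) → β}
    (hF : ∀ y, cylRadius y ≠ 0 → ContinuousAt F y) : AEMeasurable F volume := by
  have hU : IsOpen {y : EuclideanSpace ℝ (Fin 3) | cylRadius y ≠ 0} :=
    isOpen_ne_fun continuous_cylRadius continuous_const
  have hc : ContinuousOn F {y | cylRadius y ≠ 0} := fun y hy => (hF y hy).continuousWithinAt
  have h2 : volume.restrict {y : EuclideanSpace ℝ (Fin 3) | cylRadius y ≠ 0} = volume :=
    Measure.restrict_eq_self_of_ae_mem (s := {y | cylRadius y ≠ 0}) ae_cylRadius_ne_zero_volume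
  simpa only [h2] using hc.aemeasurable (μ := volume) hU.measurableSet

/-- **Tonelli over `(x₃, x')` on cylinders** (lower Lebesgue integrals, no integrability proviso):
`∫_{|x'| < R, x₃ ∈ I} G = ∫_{|w| < R} dw ∫_{z ∈ I} G(w, z) dz`, through the tree's
volume-preserving `cylSplit : ℝ³ ≃ᵐ ℝ × ℝ²`. [folklore] -/
theorem setLIntegral_cyl_eq_lintegral_lintegral {G : EuclideanSpace ℝ (Fin 3) → ℝ≥0∞}
    (hG : AEMeasurable G volume) (R : ℝ) (I : Set ℝ) :
    ∫⁻ x in {x : EuclideanSpace ℝ (Fin 3) | cylRadius x < R ∧ x 2 ∈ I}, G x =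
      ∫⁻ w in ball (0 : EuclideanSpace ℝ (Fin 2)) R, ∫⁻ z in I, G (cylSplit.symm (z, w)) := by
  have hset : {x : EuclideanSpace ℝ (Fin 3) | cylRadius x < R ∧ x 2 ∈ I} =
      cylSplit ⁻¹' (I ×ˢ ball (0 : EuclideanSpace ℝ (Fin 2)) R) := by
    ext x
    simp [cylRadius_eq_norm_cylSplit_snd, and_comm]
  have h1 : ∫⁻ x in {x : EuclideanSpace ℝ (Fin 3) | cylRadius x < R ∧ x 2 ∈ I}, G x =
      ∫⁻ q in I ×ˢ ball (0 : EuclideanSpace ℝ (Fin 2)) R, G (cylSplit.symm q) := by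
    rw [hset, ← measurePreserving_cylSplit.setLIntegral_comp_preimage_emb
      cylSplit.measurableEmbedding]
    simp only [MeasurableEquiv.symm_apply_apply]
  have hG' : AEMeasurable (fun q => G (cylSplit.symm q))
      ((volume.restrict I).prod (volume.restrict (ball (0 : EuclideanSpace ℝ (Fin 2)) R))) := by
    rw [Measure.prod_restrict, ← Measure.volume_eq_prod]
    exact ((measurePreserving_cylSplit_symm.aemeasurable_comp_iff
      cylSplit.symm.measurableEmbedding).2 hG).restrict
  rw [h1, Measure.volume_eq_prod, ← Measure.prod_restrict, lintegral_prod_symm _ hG']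

/-- **`x₃`-Poincaré on the cylinder** `𝒞(R) = spaceCyl 0 R`: for `F ∈ C¹` off the axis vanishing
where `x₃ ≤ -1`, `p ≥ 1`, `R ≤ 1`: `∫_{𝒞(R)} |F|^p ≤ 2^p R ∫_{|x'| < R, |x₃| < 1} |∂₃F|^p` — Seregin's
"`sup_{x₃}|F(r,x₃)| ≤ c(∫_{-1}^{1}|F,₃|^{10/3}dy)^{3/10}`" integrated over `𝒞(R)` (FTC along vertical
lines, Hölder on `]-1,1[`, the height `2R` of `𝒞(R)`, Tonelli). [cite: Seregin2022LocalAxisym, §2 Step 4] -/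
theorem lintegral_spaceCyl_rpow_le_lintegral_fderiv' {F : EuclideanSpace ℝ (Fin 3) → ℝ}
    (hF : ∀ y, cylRadius y ≠ 0 → ContDiffAt ℝ 1 F y)
    (hF0 : ∀ y : EuclideanSpace ℝ (Fin 3), y 2 ≤ -1 → F y = 0)
    {p : ℝ} (hp : 1 ≤ p) {R : ℝ} (hR1 : R ≤ 1) :
    ∫⁻ x in SereginSverak2009.spaceCyl 0 R, ‖F x‖ₑ ^ p ≤
      2 ^ p * ENNReal.ofReal R *
        ∫⁻ x in {x : EuclideanSpace ℝ (Fin 3) | cylRadius x < R ∧ |x 2| < 1},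
          ‖fderiv ℝ F x (EuclideanSpace.single 2 1)‖ₑ ^ p := by
  have hp0 : 0 < p := one_pos.trans_le hp
  set A : EuclideanSpace ℝ (Fin 2) → ℝ≥0∞ := fun w => ∫⁻ s in Ioo (-1 : ℝ) 1,
    ‖fderiv ℝ F (cylSplit.symm (s, w)) (EuclideanSpace.single 2 1)‖ₑ ^ p with hA
  have hcyl : SereginSverak2009.spaceCyl 0 R =
      {x : EuclideanSpace ℝ (Fin 3) | cylRadius x < R ∧ x 2 ∈ Ioo (-R) R} := by
    ext x
    simp [SereginSverak2009.spaceCyl, abs_lt, mem_Ioo]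
  have htall : {x : EuclideanSpace ℝ (Fin 3) | cylRadius x < R ∧ |x 2| < 1} =
      {x : EuclideanSpace ℝ (Fin 3) | cylRadius x < R ∧ x 2 ∈ Ioo (-1 : ℝ) 1} := by
    ext x
    simp [abs_lt, mem_Ioo]
  have hmeas : Measurable fun x => fderiv ℝ F x (EuclideanSpace.single 2 (1 : ℝ)) :=
    measurable_fderiv_apply_const ℝ F _
  rw [hcyl, htall, setLIntegral_cyl_eq_lintegral_lintegral ((aemeasurable_of_continuousAt_off_axis
      fun y hy => (hF y hy).continuousAt).enorm.pow_const p) R,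
    setLIntegral_cyl_eq_lintegral_lintegral (hmeas.enorm.pow_const p).aemeasurable R]
  -- the bound on each vertical line off the axis
  have hline : ∀ w : EuclideanSpace ℝ (Fin 2), w ≠ 0 → ∀ z ∈ Ioo (-R) R,
      ‖F (cylSplit.symm (z, w))‖ₑ ^ p ≤ 2 ^ (p - 1) * A w := by
    intro w hw z hz
    have hx : cylRadius (cylSplit.symm (z, w)) ≠ 0 := by
      rw [cylRadius_cylSplit_symm]; exact norm_ne_zero_iff.2 hw
    have h1 := enorm_le_lintegral_vline hF hF0 hx
    simp only [cylSplit_symm_apply_two, cylSplit_symm_vline] at h1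
    have h2 : ‖F (cylSplit.symm (z, w))‖ₑ ≤ ∫⁻ s in Ioo (-1 : ℝ) 1,
        ‖fderiv ℝ F (cylSplit.symm (s, w)) (EuclideanSpace.single 2 1)‖ₑ :=
      h1.trans (lintegral_mono_set (Ioc_subset_Ioo_right (hz.2.trans_le hR1)))
    have hgm : AEMeasurable (fun s : ℝ =>
        ‖fderiv ℝ F (cylSplit.symm (s, w)) (EuclideanSpace.single 2 (1 : ℝ))‖ₑ)
        (volume.restrict (Ioo (-1 : ℝ) 1)) :=
      (hmeas.comp (cylSplit.symm.measurable.comp measurable_prodMk_right)).enorm.aemeasurable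
    have h3 := lintegral_rpow_le_measure_rpow_mul (volume.restrict (Ioo (-1 : ℝ) 1)) hgm hp
    rw [Measure.restrict_apply_univ, Real.volume_Ioo,
      show (1 : ℝ) - -1 = 2 by norm_num, ENNReal.ofReal_ofNat] at h3
    exact (ENNReal.rpow_le_rpow h2 hp0.le).trans h3
  have hae : ∀ᵐ w ∂(volume.restrict (ball (0 : EuclideanSpace ℝ (Fin 2)) R)), w ≠ 0 :=
    ae_restrict_of_ae ((compl_mem_ae_iff (s := {(0 : EuclideanSpace ℝ (Fin 2))})).2
      (measure_singleton _))
  have hconst : ENNReal.ofReal (R - -R) * 2 ^ (p - 1) = 2 ^ p * ENNReal.ofReal R := by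
    rw [show R - -R = 2 * R by ring, ENNReal.ofReal_mul zero_le_two, ENNReal.ofReal_ofNat]
    conv_rhs => rw [show p = (p - 1) + 1 by ring,
      ENNReal.rpow_add _ _ two_ne_zero ENNReal.ofNat_ne_top, ENNReal.rpow_one]
    ring
  calc ∫⁻ w in ball (0 : EuclideanSpace ℝ (Fin 2)) R, ∫⁻ z in Ioo (-R) R,
          ‖F (cylSplit.symm (z, w))‖ₑ ^ p
      ≤ ∫⁻ w in ball (0 : EuclideanSpace ℝ (Fin 2)) R, ∫⁻ _z in Ioo (-R) R, 2 ^ (p - 1) * A w :=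
        lintegral_mono_ae (hae.mono fun w hw => setLIntegral_mono' measurableSet_Ioo (hline w hw))
    _ = ∫⁻ w in ball (0 : EuclideanSpace ℝ (Fin 2)) R, 2 ^ p * ENNReal.ofReal R * A w := by
        refine lintegral_congr fun w => ?_
        rw [setLIntegral_const, Real.volume_Ioo, mul_comm, ← mul_assoc, hconst]
    _ = 2 ^ p * ENNReal.ofReal R * ∫⁻ w in ball (0 : EuclideanSpace ℝ (Fin 2)) R, A w := by
        rw [lintegral_const_mul' _ _ (ENNReal.mul_ne_top
          (ENNReal.rpow_ne_top_of_nonneg hp0.le ENNReal.ofNat_ne_top) ENNReal.ofReal_ne_top)]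

/-- **`x₃`-Poincaré on the cylinder `𝒞(R)`** (registered form of the primed version): for every
`F : ℝ³ → ℝ` of class `C¹` off the axis with `F = 0` where `x₃ ≤ -1`, every `p ≥ 1` and `R ≤ 1`,
`∫_{𝒞(R)} |F|^p ≤ 2^p R ∫_{|x'| < R, |x₃| < 1} |∂₃F|^p`. [cite: Seregin2022LocalAxisym, §2 Step 4] -/
theorem lintegral_spaceCyl_rpow_le_lintegral_fderiv : ∀ (F : EuclideanSpace ℝ (Fin 3) → ℝ) (p R : ℝ), (∀ y, cylRadius y ≠ 0 → ContDiffAt ℝ 1 F y) → (∀ y : EuclideanSpace ℝ (Fin 3), y 2 ≤ -1 → F y = 0) → 1 ≤ p → R ≤ 1 → ∫⁻ x in SereginSverak2009.spaceCyl 0 R, ‖F x‖ₑ ^ p ≤ 2 ^ p * ENNReal.ofReal R * ∫⁻ x in {x : EuclideanSpace ℝ (Fin 3) | cylRadius x < R ∧ |x 2| < 1}, ‖fderiv ℝ F x (EuclideanSpace.single 2 1)‖ₑ ^ p :=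
  fun _ _ _ hF hF0 hp hR1 => lintegral_spaceCyl_rpow_le_lintegral_fderiv' hF hF0 hp hR1

/-- **The integrated `v_θ` passage of Seregin 2022, §2 Step 4**: for an axisymmetric field `v`,
`C¹` near every off-axis point of `tsupport ζ`, a `C¹` weight `ζ` (`= η³`) vanishing where
`x₃ ≤ -1`, `p ≥ 1` (`= 10/3`) and `R ≤ 1`: `∫_{𝒞(R)} |ζ v_θ|^p ≤ 2^p R ∫_{|x'|<R, |x₃|<1} (|ζ ω_r| +
|∂₃ζ · v_θ|)^p` (`ω_r = radialVelocity (curl v) = rΦ`; the `x₃`-Poincaré inequality for `F = ζ v_θ`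
and `|∂₃(ζv_θ)| ≤ |ζω_r| + |∂₃ζ||v_θ|` a.e.). [cite: Seregin2022LocalAxisym, §2 Step 4] -/
theorem lintegral_spaceCyl_mul_swirlVelocity_rpow_le : ∀ (v : EuclideanSpace ℝ (Fin 3) → EuclideanSpace ℝ (Fin 3)) (ζ : EuclideanSpace ℝ (Fin 3) → ℝ) (p R : ℝ), IsAxisymmetric v → ContDiff ℝ 1 ζ → (∀ y : EuclideanSpace ℝ (Fin 3), y 2 ≤ -1 → ζ y = 0) → (∀ y, cylRadius y ≠ 0 → y ∈ tsupport ζ → ContDiffAt ℝ 1 v y) → 1 ≤ p → R ≤ 1 → ∫⁻ x in SereginSverak2009.spaceCyl 0 R, ‖ζ x * swirlVelocity v x‖ₑ ^ p ≤ 2 ^ p * ENNReal.ofReal R * ∫⁻ x in {x : EuclideanSpace ℝ (Fin 3) | cylRadius x < R ∧ |x 2| < 1}, (‖ζ x * radialVelocity (curl v) x‖ₑ + ‖fderiv ℝ ζ x (EuclideanSpace.single 2 1) * swirlVelocity v x‖ₑ) ^ p := by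
  intro v ζ p R hax hζ hζ0 hv hp hR1
  have hp0 : 0 < p := one_pos.trans_le hp
  set F : EuclideanSpace ℝ (Fin 3) → ℝ := fun y => ζ y * swirlVelocity v y with hFdef
  -- off the support of `ζ`, `F` vanishes identically near the point
  have hzero : ∀ y, y ∉ tsupport ζ → F =ᶠ[𝓝 y] fun _ => 0 := fun y hy =>
    (notMem_tsupport_iff_eventuallyEq.1 hy).mono fun z hz => by
      simp only [Pi.zero_apply] at hz
      simp [hFdef, hz]
  have hF : ∀ y, cylRadius y ≠ 0 → ContDiffAt ℝ 1 F y := by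
    intro y hy
    by_cases hmem : y ∈ tsupport ζ
    · exact hζ.contDiffAt.mul (contDiffAt_swirlVelocity_of_contDiffAt (hv y hy hmem) hy)
    · exact contDiffAt_const.congr_of_eventuallyEq (hzero y hmem)
  have hF0 : ∀ y : EuclideanSpace ℝ (Fin 3), y 2 ≤ -1 → F y = 0 := fun y hy => by
    simp [hFdef, hζ0 y hy]
  refine (lintegral_spaceCyl_rpow_le_lintegral_fderiv' hF hF0 hp hR1).trans
    (mul_le_mul' le_rfl (lintegral_mono_ae (ae_restrict_of_ae ?_)))
  filter_upwards [ae_cylRadius_ne_zero_volume] with y hy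
  refine ENNReal.rpow_le_rpow ?_ hp0.le
  by_cases hmem : y ∈ tsupport ζ
  · rw [hFdef, fderiv_mul_swirlVelocity_single_two hax ((hv y hy hmem).differentiableAt one_ne_zero)
      hy (hζ.contDiffAt.differentiableAt one_ne_zero)]
    exact enorm_sub_le.trans_eq (add_comm _ _)
  · rw [(hzero y hmem).fderiv_eq]
    simp

end Summit.NavierStokesRegularity.NavierStokesRegularity.Theorems.AxisymmetricKatoGlobal.EulerScaling

end
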